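import Literature.AnabelianGeometry.SemiGraphs.Temperoids
import Literature.AlgebraicGeometry.Frobenioids.QuasiTemperoidConnected
import HarnessLib

/-!
# [SemiAnbd] Remark 3.1.3 (second sentence): Galois objects of `B^temp(Π)` as torsors — proof

Mochizuki, *Semi-graphs of anabelioids*, Publ. RIMS **42** (2006) 221–322, §3, manuscript p. 34,
Remark 3.1.3 [cite: MochizukiSemiAnbd2006, Rmk 3.1.3 p.34].  Proof-only companion (no definitions)
of `Literature.AnabelianGeometry.SemiGraphs.Temperoids` (seat abc-iut-L3-t2), discharging AS TYPED
the named fact `GaloisObjIffTorsor`: "a connected object `T` of `T := B^temp(Π)` is Galois if and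
only if the product `T × T` is isomorphic to the coproduct of copies of `T` indexed by the elements of
the [countable!] set `Aut_T(T)`, where the restriction to the copy labeled by `σ ∈ Aut_T(T)` of the
projection to the first (respectively, second) factor of `T × T` is given by the identity
(respectively, `σ`)" — typed as: for every product cone `P` of `(T, T)` the cofan
`(𝟙, σ)_σ : ∐_{Aut T} T → P.pt` is a colimit.  (First sentence: sibling file
`TemperoidsGaloisObjectsProofs.lean`.)

Method (abc-iut node `SemiAnbd:Rmk3.1.3`, discharge wave 3), over the landed orbit toolkit
`Literature.AlgebraicGeometry.Frobenioids.QuasiTemperoidConnected`: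
* `⇒`: in a Galois object any point is moved to any other by an automorphism (Galois condition on
  the connected span of the pair), and automorphisms agreeing at a point coincide; points of a
  product in `B^temp(Π)` are determined by their projections (again via connected spans); hence every
  point of `T × T` is `(x, σ x)` for exactly one `σ`, `σ` is constant on orbits, and a cocone
  `(f_σ)_σ` descends uniquely to `(x, y) ↦ f_{σ}(x)`.
* `⇐`: on the honest product (pairs, diagonal action) the colimit property makes the legs jointly
  surjective on points (test against the two-point trivial object); so `(ψ₂(s), ψ₁(s)) = (x, σ x)`,
  i.e. `σ ∘ ψ₂` and `ψ₁` agree at `s`, hence `ψ₁ = ψ₂ ≫ σ`.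
Plain category/group theory; no statement of the paper is strengthened.
-/

open CategoryTheory CategoryTheory.Limits Topology

namespace Literature.AnabelianGeometry.SemiGraphs

open Literature.AlgebraicGeometry.Frobenioids (IsConnectedObj IsNonemptyObj)
open Literature.AlgebraicGeometry.Frobenioids.QuasiTemperoid.BTempConnected

universe u

namespace GaloisTorsor

variable {G : Type u} [Group G] [TopologicalSpace G]

/-! ### Remark 3.1.3, second sentence (torsor characterisation) -/

/-- The two-point object `{0,1}` of `B^temp(Π)` with trivial action separates stable subsets: if a
`Π`-stable subset `I` of the points of `W` misses a point, the constant map and the indicator of `Iᶜ`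
are two morphisms `W → {0,1}` that agree on `I` and differ at that point.
[cite: MochizukiSemiAnbd2006, Rmk 3.1.3 p.34] -/
theorem exists_hom_pair_of_not_mem (W : BTemp G) (I : Set W.obj.V)
    (hI : ∀ (g : G) (w : W.obj.V), w ∈ I → W.obj.ρ g w ∈ I) (w₀ : W.obj.V) (hw₀ : w₀ ∉ I) :
    ∃ (Ω : BTemp G) (u₁ u₂ : W ⟶ Ω), (∀ w ∈ I, (u₁.hom.hom w : Ω.obj.V) = u₂.hom.hom w) ∧
      (u₁.hom.hom w₀ : Ω.obj.V) ≠ u₂.hom.hom w₀ := by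
  classical
  have hI' : ∀ (g : G) (w : W.obj.V), W.obj.ρ g w ∈ I ↔ w ∈ I := fun g w =>
    ⟨fun h => by simpa only [ρ_inv_apply] using hI g⁻¹ _ h, hI g w⟩
  let Ω : BTemp G := ⟨{ V := ULift.{u} Bool, ρ := 1 }, ⟨inferInstance, fun _ => by
    simp⟩⟩
  refine ⟨Ω, ObjectProperty.homMk
      { hom := TypeCat.ofHom fun _ => (⟨false⟩ : ULift.{u} Bool)
        comm := fun g => by
          apply ConcreteCategory.hom_ext
          intro w
          rfl },
    ObjectProperty.homMk
      { hom := TypeCat.ofHom fun w => (⟨decide (w ∉ I)⟩ : ULift.{u} Bool)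
        comm := fun g => by
          apply ConcreteCategory.hom_ext
          intro w
          change (⟨decide (W.obj.ρ g w ∉ I)⟩ : ULift.{u} Bool) = ⟨decide (w ∉ I)⟩
          rw [hI'] }, fun w hw => ?_, ?_⟩
  · change (⟨false⟩ : ULift.{u} Bool) = ⟨decide (w ∉ I)⟩
    rw [decide_eq_false (not_not_intro hw)]
  · change (⟨false⟩ : ULift.{u} Bool) ≠ ⟨decide (w₀ ∉ I)⟩
    rw [decide_eq_true hw₀]
    exact fun h => Bool.false_ne_true (congrArg ULift.down h)

/-- In a Galois object any point can be moved to any other by an automorphism: apply the Galois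
condition to the two projections of the connected span of the pair of points.
[cite: MochizukiSemiAnbd2006, Rmk 3.1.3 p.34] -/
theorem exists_aut_apply_eq_of_isGaloisObj (T : BTemp G) (hT : IsGaloisObj T) (x y : T.obj.V) :
    ∃ σ : T ≅ T, (σ.hom.hom.hom x : T.obj.V) = y := by
  obtain ⟨T₀, x₀, p₁, p₂, hT₀, hp₁, hp₂⟩ := exists_connected_span T T x y
  obtain ⟨α, hα⟩ := hT.2 T₀ hT₀ p₂ p₁
  refine ⟨α, ?_⟩
  have := congrArg (fun φ : T₀ ⟶ T => (φ.hom.hom x₀ : T.obj.V)) hα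
  simp only at this
  -- `this : p₂ x₀ = (p₁ ≫ α.hom) x₀`
  exact ((congrArg (fun z : T.obj.V => (α.hom.hom.hom z : T.obj.V)) hp₁).symm.trans
    (this.symm.trans hp₂))

/-- Automorphisms of a connected object agreeing at one point are equal.
[cite: MochizukiSemiAnbd2006, Rmk 3.1.3 p.34] -/
theorem iso_eq_of_apply_eq (T : BTemp G) (hT : IsConnectedObj T) (σ τ : T ≅ T) (x : T.obj.V)
    (h : (σ.hom.hom.hom x : T.obj.V) = τ.hom.hom.hom x) : σ = τ :=
  Iso.ext (hom_eq_of_apply_eq hT σ.hom τ.hom x h)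

/-- Points of a binary product in `B^temp(Π)` are determined by their two projections (test against
the connected span of a pair of points). [cite: MochizukiSemiAnbd2006, Rmk 3.1.3 p.34] -/
theorem binaryFan_ext {T₁ T₂ : BTemp G} (P : BinaryFan T₁ T₂) (hP : IsLimit P)
    (p p' : P.pt.obj.V) (h₁ : (P.fst.hom.hom p : T₁.obj.V) = P.fst.hom.hom p')
    (h₂ : (P.snd.hom.hom p : T₂.obj.V) = P.snd.hom.hom p') : p = p' := by
  obtain ⟨T₀, x₀, q₁, q₂, hT₀, hq₁, hq₂⟩ := exists_connected_span P.pt P.pt p p'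
  have e : q₁ = q₂ := by
    refine BinaryFan.IsLimit.hom_ext hP ?_ ?_
    · refine hom_eq_of_apply_eq hT₀ _ _ x₀ ?_
      change (P.fst.hom.hom (q₁.hom.hom x₀) : T₁.obj.V) = P.fst.hom.hom (q₂.hom.hom x₀)
      exact ((congrArg (fun z => (P.fst.hom.hom z : T₁.obj.V)) hq₁).trans h₁).trans
        (congrArg (fun z => (P.fst.hom.hom z : T₁.obj.V)) hq₂).symm
    · refine hom_eq_of_apply_eq hT₀ _ _ x₀ ?_
      change (P.snd.hom.hom (q₁.hom.hom x₀) : T₂.obj.V) = P.snd.hom.hom (q₂.hom.hom x₀)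
      exact ((congrArg (fun z => (P.snd.hom.hom z : T₂.obj.V)) hq₁).trans h₂).trans
        (congrArg (fun z => (P.snd.hom.hom z : T₂.obj.V)) hq₂).symm
  subst e
  exact hq₁.symm.trans hq₂

/-- The legs `(𝟙, σ) : T → T × T` of the torsor cofan, evaluated on points: first projection.
[cite: MochizukiSemiAnbd2006, Rmk 3.1.3 p.34] -/
theorem fst_lift_apply {T : BTemp G} (P : BinaryFan T T) (hP : IsLimit P) (σ : T ≅ T)
    (x : T.obj.V) :
    (P.fst.hom.hom ((hP.lift (BinaryFan.mk (𝟙 T) σ.hom)).hom.hom x) : T.obj.V) = x := by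
  have h : hP.lift (BinaryFan.mk (𝟙 T) σ.hom) ≫ P.fst = 𝟙 T :=
    hP.fac (BinaryFan.mk (𝟙 T) σ.hom) ⟨WalkingPair.left⟩
  exact congrArg (fun φ : T ⟶ T => (φ.hom.hom x : T.obj.V)) h

/-- The legs `(𝟙, σ) : T → T × T` of the torsor cofan, evaluated on points: second projection.
[cite: MochizukiSemiAnbd2006, Rmk 3.1.3 p.34] -/
theorem snd_lift_apply {T : BTemp G} (P : BinaryFan T T) (hP : IsLimit P) (σ : T ≅ T)
    (x : T.obj.V) :
    (P.snd.hom.hom ((hP.lift (BinaryFan.mk (𝟙 T) σ.hom)).hom.hom x) : T.obj.V) =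
      σ.hom.hom.hom x := by
  have h : hP.lift (BinaryFan.mk (𝟙 T) σ.hom) ≫ P.snd = σ.hom :=
    hP.fac (BinaryFan.mk (𝟙 T) σ.hom) ⟨WalkingPair.right⟩
  exact congrArg (fun φ : T ⟶ T => (φ.hom.hom x : T.obj.V)) h

/-- The legs of the torsor cofan are equivariant (as all morphisms of `B^temp(Π)` are), so their
joint image is a `Π`-stable set of points. [cite: MochizukiSemiAnbd2006, Rmk 3.1.3 p.34] -/
theorem lift_apply_ρ {T : BTemp G} (P : BinaryFan T T) (hP : IsLimit P) (σ : T ≅ T)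
    (g : G) (x : T.obj.V) :
    ((hP.lift (BinaryFan.mk (𝟙 T) σ.hom)).hom.hom (T.obj.ρ g x) : P.pt.obj.V) =
      P.pt.obj.ρ g ((hP.lift (BinaryFan.mk (𝟙 T) σ.hom)).hom.hom x) :=
  hom_ρ _ g x

/-- **Remark 3.1.3, second sentence, `⇒`**: for a Galois object `T` and any product `T × T` in
`B^temp(Π)`, the cofan `(𝟙, σ)_σ : ∐_{σ ∈ Aut T} T → T × T` is a coproduct — every point `(x, y)` of
`T × T` is `(x, σ x)` for exactly one `σ`, and `σ` is constant along the orbit of `(x, y)`, so a cocone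
`(f_σ)_σ` descends to `(x, y) ↦ f_σ(x)`. [cite: MochizukiSemiAnbd2006, Rmk 3.1.3 p.34] -/
theorem cofan_isColimit_of_isGaloisObj (T : BTemp G) (hT : IsGaloisObj T) (P : BinaryFan T T)
    (hP : IsLimit P) :
    Nonempty (IsColimit (Cofan.mk P.pt fun σ : Aut T =>
      (hP.lift (BinaryFan.mk (𝟙 T) σ.hom) : T ⟶ P.pt))) := by
  classical
  have hconn : IsConnectedObj T := hT.1
  -- notation: the legs, and the automorphism attached to a point of `T × T`
  let leg : (T ≅ T) → (T ⟶ P.pt) := fun σ => hP.lift (BinaryFan.mk (𝟙 T) σ.hom)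
  let sel : P.pt.obj.V → (T ≅ T) := fun p =>
    (exists_aut_apply_eq_of_isGaloisObj T hT (P.fst.hom.hom p) (P.snd.hom.hom p)).choose
  have hsel : ∀ p : P.pt.obj.V,
      ((sel p).hom.hom.hom (P.fst.hom.hom p) : T.obj.V) = P.snd.hom.hom p := fun p =>
    (exists_aut_apply_eq_of_isGaloisObj T hT (P.fst.hom.hom p) (P.snd.hom.hom p)).choose_spec
  have hsel_eq : ∀ (p : P.pt.obj.V) (σ : T ≅ T),
      ((σ.hom.hom.hom (P.fst.hom.hom p) : T.obj.V) = P.snd.hom.hom p) → sel p = σ :=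
    fun p σ h => iso_eq_of_apply_eq T hconn _ _ _ ((hsel p).trans h.symm)
  -- every point `p` is `leg (sel p) (fst p)`
  have hpt : ∀ p : P.pt.obj.V, ((leg (sel p)).hom.hom (P.fst.hom.hom p) : P.pt.obj.V) = p :=
    fun p => binaryFan_ext P hP _ _ (fst_lift_apply P hP _ _)
      ((snd_lift_apply P hP _ _).trans (hsel p))
  -- `sel` is constant on orbits and recovers `σ` on the image of `leg σ`
  have hsel_ρ : ∀ (g : G) (p : P.pt.obj.V), sel (P.pt.obj.ρ g p) = sel p := fun g p =>
    hsel_eq _ _ <|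
      ((congrArg (fun z : T.obj.V => ((sel p).hom.hom.hom z : T.obj.V)) (hom_ρ P.fst g p)).trans
        (hom_ρ (sel p).hom g (P.fst.hom.hom p))).trans <|
      (congrArg (T.obj.ρ g) (hsel p)).trans (hom_ρ P.snd g p).symm
  have hsel_leg : ∀ (σ : T ≅ T) (x : T.obj.V), sel ((leg σ).hom.hom x) = σ := fun σ x =>
    hsel_eq _ _ <| (congrArg (fun z : T.obj.V => (σ.hom.hom.hom z : T.obj.V))
      (fst_lift_apply P hP σ x)).trans (snd_lift_apply P hP σ x).symm
  -- the descent morphism of a cocone `s`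
  let desc : ∀ s : Cofan fun _ : Aut T => T, P.pt ⟶ s.pt := fun s =>
    ObjectProperty.homMk
      { hom := TypeCat.ofHom fun p => (s.inj (sel p)).hom.hom (P.fst.hom.hom p)
        comm := fun g => by
          apply ConcreteCategory.hom_ext
          intro p
          change ((s.inj (sel (P.pt.obj.ρ g p))).hom.hom (P.fst.hom.hom (P.pt.obj.ρ g p)) :
              s.pt.obj.V) = s.pt.obj.ρ g ((s.inj (sel p)).hom.hom (P.fst.hom.hom p))
          rw [hsel_ρ]
          exact (congrArg (fun z : T.obj.V => ((s.inj (sel p)).hom.hom z : s.pt.obj.V))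
            (hom_ρ P.fst g p)).trans (hom_ρ (s.inj (sel p)) g _) }
  have hdesc : ∀ (s : Cofan fun _ : Aut T => T) (p : P.pt.obj.V),
      ((desc s).hom.hom p : s.pt.obj.V) = (s.inj (sel p)).hom.hom (P.fst.hom.hom p) :=
    fun s p => rfl
  refine ⟨Cofan.IsColimit.mk _ desc (fun s σ => ?_) (fun s m hm => ?_)⟩
  · -- `leg σ ≫ desc s = s.inj σ`
    apply hom_ext_apply
    intro x
    change ((desc s).hom.hom ((leg σ).hom.hom x) : s.pt.obj.V) = (s.inj σ).hom.hom x
    rw [hdesc, hsel_leg]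
    exact congrArg (fun z : T.obj.V => ((s.inj σ).hom.hom z : s.pt.obj.V)) (fst_lift_apply P hP σ x)
  · -- uniqueness
    apply hom_ext_apply
    intro p
    have := congrArg (fun φ : T ⟶ s.pt => (φ.hom.hom (P.fst.hom.hom p) : s.pt.obj.V)) (hm (sel p))
    simp only at this
    -- `this : (leg (sel p) ≫ m) (fst p) = s.inj (sel p) (fst p)`
    exact ((congrArg (fun z : P.pt.obj.V => (m.hom.hom z : s.pt.obj.V)) (hpt p)).symm.trans
      this).trans (hdesc s p).symm

/-- **Remark 3.1.3, second sentence, `⇐`**: if the torsor cofan is a coproduct for every product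
`T × T`, then the connected object `T` is Galois — using the honest product `T × T` (pairs with the
diagonal action, an object of `B^temp(Π)`): the legs `(𝟙, σ)` are then jointly surjective on points,
so `(ψ₂(s), ψ₁(s)) = (x, σ x)` for some `σ`, i.e. `σ(ψ₂(s)) = ψ₁(s)` and `ψ₁ = ψ₂ ≫ σ`.
[cite: MochizukiSemiAnbd2006, Rmk 3.1.3 p.34] -/
theorem isGaloisObj_of_cofan_isColimit (T : BTemp G) (hT : IsConnectedObj T)
    (h : ∀ (P : BinaryFan T T) (hP : IsLimit P),
      Nonempty (IsColimit (Cofan.mk P.pt fun σ : Aut T =>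
        (hP.lift (BinaryFan.mk (𝟙 T) σ.hom) : T ⟶ P.pt)))) :
    IsGaloisObj T := by
  classical
  letI : MulAction G T.obj.V := Action.instMulAction T.obj
  -- the honest product `T × T`
  let VA : Action (Type u) G := Action.ofMulAction G (T.obj.V × T.obj.V)
  let V : BTemp G :=
    ⟨VA, by
      haveI : Countable T.obj.V := T.property.1
      refine ⟨inferInstanceAs (Countable (T.obj.V × T.obj.V)), fun (y : T.obj.V × T.obj.V) => ?_⟩
      have : {g : G | VA.ρ g y = y} =
          {g : G | T.obj.ρ g y.1 = y.1} ∩ {g : G | T.obj.ρ g y.2 = y.2} := by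
        ext g
        simp only [Set.mem_setOf_eq, Set.mem_inter_iff]
        change g • y = y ↔ g • y.1 = y.1 ∧ g • y.2 = y.2
        rw [Prod.ext_iff, Prod.smul_fst, Prod.smul_snd]
      rw [this]
      exact (T.property.2 y.1).inter (T.property.2 y.2)⟩
  let π₁ : V ⟶ T := ObjectProperty.homMk
    { hom := TypeCat.ofHom fun y : T.obj.V × T.obj.V => y.1
      comm := fun g => by
        apply ConcreteCategory.hom_ext
        intro y
        rfl }
  let π₂ : V ⟶ T := ObjectProperty.homMk
    { hom := TypeCat.ofHom fun y : T.obj.V × T.obj.V => y.2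
      comm := fun g => by
        apply ConcreteCategory.hom_ext
        intro y
        rfl }
  let P : BinaryFan T T := BinaryFan.mk π₁ π₂
  have hP : IsLimit P := by
    refine BinaryFan.isLimitMk
      (fun s => ObjectProperty.homMk
        { hom := TypeCat.ofHom fun w => ((s.fst.hom.hom w, s.snd.hom.hom w) : T.obj.V × T.obj.V)
          comm := fun g => ?_ }) ?_ ?_ ?_
    · apply ConcreteCategory.hom_ext
      intro w
      change (((s.fst.hom.hom (s.pt.obj.ρ g w) : T.obj.V), (s.snd.hom.hom (s.pt.obj.ρ g w) : T.obj.V))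
          : T.obj.V × T.obj.V) =
        g • (((s.fst.hom.hom w : T.obj.V), (s.snd.hom.hom w : T.obj.V)) : T.obj.V × T.obj.V)
      exact Prod.ext (hom_ρ s.fst g w) (hom_ρ s.snd g w)
    · intro s
      apply hom_ext_apply
      intro w
      rfl
    · intro s
      apply hom_ext_apply
      intro w
      rfl
    · intro s m h₁ h₂
      apply hom_ext_apply
      intro w
      change (m.hom.hom w : T.obj.V × T.obj.V) = (s.fst.hom.hom w, s.snd.hom.hom w)
      rw [← h₁, ← h₂]
      rfl
  obtain ⟨hc⟩ := h P hP
  refine ⟨hT, fun S hS ψ₁ ψ₂ => ?_⟩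
  obtain ⟨s⟩ := nonempty_of_isConnectedObj S hS
  -- the joint image of the legs is a stable subset containing every point
  let I : Set P.pt.obj.V :=
    {p | ∃ (σ : T ≅ T) (x : T.obj.V), (hP.lift (BinaryFan.mk (𝟙 T) σ.hom)).hom.hom x = p}
  have hIρ : ∀ (g : G) (p : P.pt.obj.V), p ∈ I → P.pt.obj.ρ g p ∈ I := by
    rintro g p ⟨σ, x, rfl⟩
    exact ⟨σ, T.obj.ρ g x, lift_apply_ρ P hP σ g x⟩
  let p₀ : P.pt.obj.V := ((ψ₂.hom.hom s, ψ₁.hom.hom s) : T.obj.V × T.obj.V)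
  have hI : p₀ ∈ I := by
    by_contra hnot
    obtain ⟨Ω, u₁, u₂, hu, hne⟩ := exists_hom_pair_of_not_mem P.pt I hIρ p₀ hnot
    apply hne
    have : u₁ = u₂ := by
      refine Cofan.IsColimit.hom_ext hc _ _ fun σ => hom_ext_apply fun x => ?_
      exact hu _ ⟨σ, x, rfl⟩
    rw [this]
  obtain ⟨σ, x, hx⟩ := hI
  refine ⟨σ, hom_eq_of_apply_eq hS _ _ s ?_⟩
  have h1 : (P.fst.hom.hom ((hP.lift (BinaryFan.mk (𝟙 T) σ.hom)).hom.hom x) : T.obj.V) =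
      ψ₂.hom.hom s := congrArg (fun p : T.obj.V × T.obj.V => p.1) hx
  have h2 : (P.snd.hom.hom ((hP.lift (BinaryFan.mk (𝟙 T) σ.hom)).hom.hom x) : T.obj.V) =
      ψ₁.hom.hom s := congrArg (fun p : T.obj.V × T.obj.V => p.2) hx
  have e1 : x = ψ₂.hom.hom s := (fst_lift_apply P hP σ x).symm.trans h1
  have e2 : (σ.hom.hom.hom x : T.obj.V) = ψ₁.hom.hom s := (snd_lift_apply P hP σ x).symm.trans h2
  change (ψ₁.hom.hom s : T.obj.V) = σ.hom.hom.hom (ψ₂.hom.hom s)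
  rw [← e1]
  exact e2.symm

end GaloisTorsor

open GaloisTorsor in
/-- **[SemiAnbd] Remark 3.1.3, second sentence — DISCHARGED** (named fact `GaloisObjIffTorsor` of
`Temperoids.lean`): for `Π` tempered and `T` a connected object of `B^temp(Π)`, `T` is Galois iff,
for every product `T × T`, the cofan `(𝟙, σ)_{σ ∈ Aut T} : ∐ T → T × T` is a coproduct.
[cite: MochizukiSemiAnbd2006, Rmk 3.1.3 p.34] -/
theorem GaloisObjIffTorsor_holds :
    ∀ (G : Type u) [Group G] [TopologicalSpace G] [IsTopologicalGroup G],
      GaloisObjIffTorsor G := fun _ _ _ _ _ T hT =>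
  ⟨fun hgal P hP => cofan_isColimit_of_isGaloisObj T hgal P hP,
    fun h => isGaloisObj_of_cofan_isColimit T hT h⟩

end Literature.AnabelianGeometry.SemiGraphs
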